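import Literature.MathematicalPhysics.QuantumFieldTheory.Balaban1983to89.Beta.PeriodicDescent

/-!
# `BalabanUV.Beta.GAN24.HarmonicPeriodicTwoForm` — binder row G-an2-4 ∕ (CONV-C), W-slot CT-W, conservation law (C)∕(C)sym: **A HARMONIC BLOCK-PERIODIC
# 2-FORM ON `ℤ^d` IS CONSTANT** — if a block-periodic antisymmetric 2-form `Y` is CO-CLOSED (`curvAdj Y = 0`) and CLOSED (its cyclic forward differences
# vanish), then every component `Y κ l` is a constant; corollary: for a block-periodic 1-form `A` and a block-periodic closed 2-form `F` with
# `curvAdj (curv A + c·F) = 0`, **`curv A + c·F` is the constant `c·(cell average of F)`** (fact (H2-torus) = step (iv) of the resolvent flux identity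
# (d′) of this lineage's note `HOME/b2b-balaban-gan24-formalise-leaf-04/g64/CSYM-D3-ANATOMY.md` §8; generic `d`, every period `N ≥ 1`)

NOT IN PRINT; OUR BOOKKEEPING ([folklore] discrete exterior calculus on the cubic torus, over `AffineAveraging` (`dz ∕ curv ∕ curvAdj ∕ box ∕ toSite`) and
an2's `PeriodicDescent` (`IsPeriodic`, `lift0`, `eq_lift0_of_isPeriodic`, `sum_box_proj`, `const_of_dz_eq_zero`) BY NAME; G-an2-4 formalisation swarm,
leaf prover `b2b-balaban-gan24-formalise-leaf-04`, gen 64).  HONEST FRAMING (cell contract, verbatim): «discharging `BetaPertH` makes Bałaban's UV stability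
UNCONDITIONAL — a real constructive-QFT result; it is NOT the continuum limit and NOT the Clay problem.»  HONEST DEPENDENCY (verbatim): «continuum YM on T⁴ ⇐
BetaPertH ∧ nine spine estimates (0/9 proved); BetaPertH ⇐ (D1) ∧ (D4) ∧ CAP+tail; G-an2-4 gates asym, D1 and NE2/3/4.»

WHY (the located use, note §8 (d′)): in the zero mode of one dressed second-order step the cubic × cubic EXCHANGE word is `⟨J′, K·J⟩_cell` with `J = −½·curvAdj F`
the edge current of `GAN24.WilsonEdgeCurrent` (`F = p ⊗ q` a closed plaquette-column 2-form) and `K` the `U = 1` KKT resolvent; the response `A := (K·J)_field`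
has multiplier `φ = 0` (`GAN24.PeriodicForceMultiplier`), the gauge term of the Euler–Lagrange row then drops, so `curvAdj (curv A) = J`, i.e.
`curvAdj (curv A + ½F) = 0`; `curv A + ½F` is closed (Bianchi + `F` closed) — hence HARMONIC, hence CONSTANT by this file, hence `= ½·avg F`: the flux
identity `curv (K·J) = ½(avg F − F)` with NO Green's function, which evaluates the exchange to `−(Lc² − 1)·(undressed contact)`.

MECHANISM (generic `d`; no Fourier analysis): §1 cell sums of block-periodic fields are shift invariant (`sum_box_shift`, via `sum_box_proj` and a torus
translation) and a block-periodic field vanishing on one cell vanishes (`eq_zero_of_periodic_of_box`); §2 the torus ENERGY IDENTITY per direction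
`Σ_cell (f(x+e_m) − f x)² = −Σ_cell f x·(f(x+e_m) − 2 f x + f(x−e_m))` (`sum_box_sq_dz_eq`), so a block-periodic field with zero lattice Laplacian has `dz f = 0`
(`dz_eq_zero_of_periodic_lap_eq_zero`) and is constant; §3 the WEITZENBÖCK step: for an antisymmetric 2-form, co-closed + closed ⇒ every component has zero
lattice Laplacian (`lap_eq_zero_of_coclosed_closed`: the cyclic identity at `x` and at `x − e_m`, summed over `m`, regroups into forward differences of the two
co-closedness sums) ⇒ **`const_of_harmonic_periodic`**; §4 curvature is antisymmetric, satisfies the cyclic (Bianchi) identity and has zero cell sums for a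
periodic potential (`curv_antisymm`, `curv_cyclic`, `sum_box_curv_eq_zero`) ⇒ **`curv_add_eq_const`** and **`card_mul_const_eq_sum_box`** (the constant is
`c·avg F`).

WHAT ([folklore]; 0 `def`, 0 cited facts, 0 `def … : Prop`, 0 sorry): the theorems named above.  Asserts NO value of Bałaban's tables; discharges NOTHING of (C)sym ∕
(Q-D) ∕ (Q-D-rate) ∕ «T2Shape» ∕ «T2Drift» ∕ (hW, hWall); the remaining steps (P1) periodic cell pairings, (P2) «the periodic KKT response SolvesKKT», (P4)∕(P5) assembly
are NOT here; NEVER «G-an2-4 closed» as (CONV-C); NOT D1, NOT `BetaPertH`, NOT continuum, NOT Clay.  2026-08-22; no existing file touched.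
-/

noncomputable section

open Finset
open scoped BigOperators
open Literature.MathematicalPhysics.QuantumFieldTheory
open Literature.MathematicalPhysics.QuantumFieldTheory.Balaban1983to89.Beta
open Literature.Probability.LatticeModels (TorusSite Torus.proj Torus.proj_apply)
open AffineAveraging (Form0 Form1 Form2 unitVec dz curv curvAdj box toSite)
open OneBlockTorusKKT (𝕋)
open LatticeForm (exists_eq_add_zsmul_of_proj_eq)
open PeriodicDescent (IsPeriodic lift0 lift0_apply eq_lift0_of_isPeriodic sum_box_proj const_of_dz_eq_zero proj_add)

namespace Summit.QuantumFields.BalabanUV.Beta.GAN24.HarmonicPeriodicTwoForm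

variable {d N : ℕ} [NeZero N]

/-! ## §1 Cell sums of block-periodic fields -/

/-- [folklore] **CELL SUMS OF A BLOCK-PERIODIC FIELD ARE SHIFT INVARIANT**: `Σ_{r ∈ box} f (toSite r + v) = Σ_{r ∈ box} f (toSite r)` for every shift `v`
(the box parametrises the torus `𝕋 d N`; translation is a bijection of the torus). -/
theorem sum_box_shift {f : Form0 d ℝ} (hf : IsPeriodic N f) (v : AffineAveraging.Site d) :
    ∑ r ∈ box d N, f (toSite r + v) = ∑ r ∈ box d N, f (toSite r) := by
  rw [eq_lift0_of_isPeriodic f hf]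
  set u : 𝕋 d N → ℝ := fun z => f (LatticeForm.repZ z) with hu
  simp only [lift0_apply, proj_add]
  rw [sum_box_proj (N := N) (fun z => u (z + Torus.proj N v)), sum_box_proj (N := N) u]
  exact Fintype.sum_equiv (Equiv.addRight (Torus.proj N v)) _ _ fun z => rfl

/-- [folklore] A block-periodic field that vanishes on one cell vanishes everywhere. -/
theorem eq_zero_of_periodic_of_box {h : Form0 d ℝ} (hh : IsPeriodic N h) (h0 : ∀ r ∈ box d N, h (toSite r) = 0)
    (x : AffineAveraging.Site d) : h x = 0 := by
  set z : 𝕋 d N := Torus.proj N x with hz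
  have hb : (fun j => (z j).val) ∈ box d N := by
    show (fun j => (z j).val) ∈ Fintype.piFinset fun _ => Finset.range N
    simp only [Fintype.mem_piFinset, Finset.mem_range]
    exact fun j => ZMod.val_lt (z j)
  have hp : Torus.proj N (toSite (fun j => (z j).val)) = Torus.proj N x := by
    funext j
    simp only [Torus.proj_apply, toSite, Int.cast_natCast, ZMod.natCast_zmod_val, hz]
  obtain ⟨a, ha⟩ := exists_eq_add_zsmul_of_proj_eq hp
  rw [ha, hh]
  exact h0 _ hb

/-! ## §2 The torus energy identity: zero lattice Laplacian ⇒ zero gradient ⇒ constant -/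

/-- [folklore] **ENERGY IDENTITY PER DIRECTION** on one cell of a block-periodic field:
`Σ_{r ∈ box} (f(x + e_m) − f x)² = −Σ_{r ∈ box} f x·(f(x + e_m) − 2·f x + f(x − e_m))` (`x = toSite r`; two shift-invariant regroupings). -/
theorem sum_box_sq_dz_eq {f : Form0 d ℝ} (hf : IsPeriodic N f) (m : Fin d) :
    ∑ r ∈ box d N, (f (toSite r + unitVec m) - f (toSite r)) ^ 2 =
      -∑ r ∈ box d N, f (toSite r) * (f (toSite r + unitVec m) - 2 * f (toSite r) + f (toSite r - unitVec m)) := by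
  have h1 : ∑ r ∈ box d N, f (toSite r + unitVec m) ^ 2 = ∑ r ∈ box d N, f (toSite r) ^ 2 :=
    sum_box_shift (N := N) (f := fun x => f x ^ 2) (fun x a => by simp only [hf x a]) (unitVec m)
  have h2 : ∑ r ∈ box d N, f (toSite r + unitVec m) * f (toSite r) = ∑ r ∈ box d N, f (toSite r) * f (toSite r - unitVec m) := by
    have e := sum_box_shift (N := N) (f := fun x => f x * f (x - unitVec m))
      (fun x a => by simp only; rw [show x + (N : ℤ) • a - unitVec m = (x - unitVec m) + (N : ℤ) • a by abel, hf, hf]) (unitVec m)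
    simp only [add_sub_cancel_right] at e
    exact e
  rw [eq_neg_iff_add_eq_zero, ← Finset.sum_add_distrib]
  have e3 : ∀ r : Fin d → ℕ, (f (toSite r + unitVec m) - f (toSite r)) ^ 2 +
      f (toSite r) * (f (toSite r + unitVec m) - 2 * f (toSite r) + f (toSite r - unitVec m)) =
      (f (toSite r + unitVec m) ^ 2 - f (toSite r) ^ 2) + (f (toSite r) * f (toSite r - unitVec m) - f (toSite r + unitVec m) * f (toSite r)) := by
    intro r; ring
  rw [Finset.sum_congr rfl fun r _ => e3 r, Finset.sum_add_distrib, Finset.sum_sub_distrib, Finset.sum_sub_distrib, h1, h2, sub_self,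
    sub_self, add_zero]

/-- [folklore] **A BLOCK-PERIODIC FIELD WITH ZERO LATTICE LAPLACIAN HAS ZERO GRADIENT** (sum the energy identities over the directions: `Σ_m Σ_cell |∇_m f|² =
−Σ_cell f·Δf = 0`, every term is a square; a periodic gradient vanishing on one cell vanishes). -/
theorem dz_eq_zero_of_periodic_lap_eq_zero {f : Form0 d ℝ} (hf : IsPeriodic N f)
    (hlap : ∀ x, ∑ m, (f (x + unitVec m) - 2 * f x + f (x - unitVec m)) = 0) : dz f = 0 := by
  have hsum : ∑ m, ∑ r ∈ box d N, (f (toSite r + unitVec m) - f (toSite r)) ^ 2 = 0 := by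
    rw [Finset.sum_congr rfl fun m _ => sum_box_sq_dz_eq (N := N) hf m, Finset.sum_neg_distrib, Finset.sum_comm]
    simp only [← Finset.mul_sum, hlap, mul_zero, Finset.sum_const_zero, neg_zero]
  have hm : ∀ m, ∑ r ∈ box d N, (f (toSite r + unitVec m) - f (toSite r)) ^ 2 = 0 := fun m =>
    (Finset.sum_eq_zero_iff_of_nonneg fun m' _ => Finset.sum_nonneg fun r _ => sq_nonneg _).1 hsum m (Finset.mem_univ m)
  have hterm : ∀ m, ∀ r ∈ box d N, f (toSite r + unitVec m) - f (toSite r) = 0 := fun m r hr =>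
    (pow_eq_zero_iff two_ne_zero).1 ((Finset.sum_eq_zero_iff_of_nonneg fun r' _ => sq_nonneg _).1 (hm m) r hr)
  funext m x
  have hper : IsPeriodic N (fun y => f (y + unitVec m) - f y) := fun y a => by
    simp only
    rw [add_right_comm, hf, hf]
  have h := eq_zero_of_periodic_of_box (N := N) hper (hterm m) x
  simpa [dz] using h

/-- [folklore] … hence it is CONSTANT (`PeriodicDescent.const_of_dz_eq_zero`). -/
theorem const_of_periodic_lap_eq_zero {f : Form0 d ℝ} (hf : IsPeriodic N f)
    (hlap : ∀ x, ∑ m, (f (x + unitVec m) - 2 * f x + f (x - unitVec m)) = 0) (x : AffineAveraging.Site d) : f x = f 0 :=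
  const_of_dz_eq_zero f (dz_eq_zero_of_periodic_lap_eq_zero (N := N) hf hlap) x

/-! ## §3 Harmonic 2-forms: co-closed + closed ⇒ zero Laplacian ⇒ constant -/

omit [NeZero N] in
/-- [folklore] **WEITZENBÖCK STEP ON THE CUBIC LATTICE**: for an antisymmetric 2-form `Y` which is CO-CLOSED (`curvAdj Y = 0`) and CLOSED (the cyclic forward
differences `∇_κ Y_{lm} + ∇_l Y_{mκ} + ∇_m Y_{κl}` vanish), every component has zero lattice Laplacian:
`Σ_m (Y κ l (x + e_m) − 2·Y κ l x + Y κ l (x − e_m)) = 0` (pointwise; no periodicity needed). -/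
theorem lap_eq_zero_of_coclosed_closed {Y : Form2 d ℝ} (hanti : ∀ κ l x, Y κ l x = -Y l κ x) (hco : curvAdj Y = 0)
    (hcl : ∀ (κ l m : Fin d) (x : AffineAveraging.Site d),
      (Y l m (x + unitVec κ) - Y l m x) + (Y m κ (x + unitVec l) - Y m κ x) + (Y κ l (x + unitVec m) - Y κ l x) = 0)
    (κ l : Fin d) (x : AffineAveraging.Site d) :
    ∑ m, (Y κ l (x + unitVec m) - 2 * Y κ l x + Y κ l (x - unitVec m)) = 0 := by
  -- the co-closedness sums: `G l y := Σ_m (Y l m y − Y l m (y − e_m)) = ½·(curvAdj Y) l y = 0`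
  have hG : ∀ (l : Fin d) (y : AffineAveraging.Site d), ∑ m, (Y l m y - Y l m (y - unitVec m)) = 0 := by
    intro l y
    have h := congrFun (congrFun hco l) y
    simp only [curvAdj, Pi.zero_apply] at h
    have e2 : ∑ m, (Y m l (y - unitVec m) - Y m l y) = ∑ m, (Y l m y - Y l m (y - unitVec m)) :=
      Finset.sum_congr rfl fun m _ => by rw [hanti m l, hanti m l]; ring
    rw [e2] at h
    linarith
  have hH : ∀ (κ : Fin d) (y : AffineAveraging.Site d), ∑ m, (Y m κ y - Y m κ (y - unitVec m)) = 0 := by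
    intro κ y
    have e := hG κ y
    have e2 : ∑ m, (Y m κ y - Y m κ (y - unitVec m)) = -∑ m, (Y κ m y - Y κ m (y - unitVec m)) := by
      rw [← Finset.sum_neg_distrib]
      exact Finset.sum_congr rfl fun m _ => by rw [hanti m κ, hanti m κ]; ring
    rw [e2, e, neg_zero]
  -- the cyclic identity at `x` and at `x − e_m`
  have step : ∀ m : Fin d, Y κ l (x + unitVec m) - 2 * Y κ l x + Y κ l (x - unitVec m) =
      -((Y l m (x + unitVec κ) - Y l m (x + unitVec κ - unitVec m)) - (Y l m x - Y l m (x - unitVec m)))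
        - ((Y m κ (x + unitVec l) - Y m κ (x + unitVec l - unitVec m)) - (Y m κ x - Y m κ (x - unitVec m))) := by
    intro m
    have h1 := hcl κ l m x
    have h2 := hcl κ l m (x - unitVec m)
    rw [sub_add_cancel, show x - unitVec m + unitVec κ = x + unitVec κ - unitVec m by abel,
      show x - unitVec m + unitVec l = x + unitVec l - unitVec m by abel] at h2
    linarith
  rw [Finset.sum_congr rfl fun m _ => step m]
  simp only [Finset.sum_sub_distrib, Finset.sum_neg_distrib, hG l (x + unitVec κ), hG l x, hH κ (x + unitVec l), hH κ x]
  ring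

/-- [folklore] **A HARMONIC BLOCK-PERIODIC 2-FORM IS CONSTANT**: block-periodic, antisymmetric, co-closed and closed ⇒ every component is constant. -/
theorem const_of_harmonic_periodic {Y : Form2 d ℝ} (hP : ∀ κ l, IsPeriodic N (Y κ l)) (hanti : ∀ κ l x, Y κ l x = -Y l κ x)
    (hco : curvAdj Y = 0)
    (hcl : ∀ (κ l m : Fin d) (x : AffineAveraging.Site d),
      (Y l m (x + unitVec κ) - Y l m x) + (Y m κ (x + unitVec l) - Y m κ x) + (Y κ l (x + unitVec m) - Y κ l x) = 0)
    (κ l : Fin d) (x : AffineAveraging.Site d) : Y κ l x = Y κ l 0 :=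
  const_of_periodic_lap_eq_zero (N := N) (hP κ l) (fun y => lap_eq_zero_of_coclosed_closed hanti hco hcl κ l y) x

/-! ## §4 Curvature plus a closed 2-form: co-closed ⇒ constant = the cell average -/

omit [NeZero N] in
/-- [folklore] `curv A` is antisymmetric. -/
theorem curv_antisymm (A : Form1 d ℝ) (κ l : Fin d) (x : AffineAveraging.Site d) : curv A κ l x = -curv A l κ x := by
  simp only [curv]
  ring

omit [NeZero N] in
/-- [folklore] The cyclic (Bianchi) identity `d ∘ d = 0` on 1-forms, componentwise. -/
theorem curv_cyclic (A : Form1 d ℝ) (κ l m : Fin d) (x : AffineAveraging.Site d) :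
    (curv A l m (x + unitVec κ) - curv A l m x) + (curv A m κ (x + unitVec l) - curv A m κ x) +
      (curv A κ l (x + unitVec m) - curv A κ l x) = 0 := by
  simp only [curv]
  rw [show x + unitVec κ + unitVec l = x + unitVec l + unitVec κ by abel, show x + unitVec m + unitVec κ = x + unitVec κ + unitVec m by abel,
    show x + unitVec l + unitVec m = x + unitVec m + unitVec l by abel]
  ring

/-- [folklore] The curvature of a block-periodic 1-form has zero cell sums. -/
theorem sum_box_curv_eq_zero {A : Form1 d ℝ} (hA : ∀ κ, IsPeriodic N (A κ)) (κ l : Fin d) :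
    ∑ r ∈ box d N, curv A κ l (toSite r) = 0 := by
  simp only [curv, Finset.sum_sub_distrib, Finset.sum_add_distrib, sum_box_shift (N := N) (hA l) (unitVec κ),
    sum_box_shift (N := N) (hA κ) (unitVec l)]
  ring

/-- [folklore] **`curv A + c·F` CO-CLOSED ⇒ CONSTANT** for a block-periodic 1-form `A` and a block-periodic, antisymmetric, closed 2-form `F`. -/
theorem curv_add_eq_const {A : Form1 d ℝ} {F : Form2 d ℝ} (hA : ∀ κ, IsPeriodic N (A κ)) (hF : ∀ κ l, IsPeriodic N (F κ l))
    (hFa : ∀ κ l x, F κ l x = -F l κ x)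
    (hFcl : ∀ (κ l m : Fin d) (x : AffineAveraging.Site d),
      (F l m (x + unitVec κ) - F l m x) + (F m κ (x + unitVec l) - F m κ x) + (F κ l (x + unitVec m) - F κ l x) = 0)
    (c : ℝ) (hco : curvAdj (fun κ l x => curv A κ l x + c * F κ l x) = 0) (κ l : Fin d) (x : AffineAveraging.Site d) :
    curv A κ l x + c * F κ l x = curv A κ l 0 + c * F κ l 0 := by
  refine const_of_harmonic_periodic (N := N) (Y := fun κ l x => curv A κ l x + c * F κ l x) ?_ ?_ hco ?_ κ l x
  · intro κ' l' y a
    have hcurv : IsPeriodic N (curv A κ' l') := fun y a => by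
      simp only [curv]
      rw [show y + (N : ℤ) • a + unitVec κ' = (y + unitVec κ') + (N : ℤ) • a by abel,
        show y + (N : ℤ) • a + unitVec l' = (y + unitVec l') + (N : ℤ) • a by abel, hA, hA, hA, hA]
    show curv A κ' l' (y + (N : ℤ) • a) + c * F κ' l' (y + (N : ℤ) • a) = curv A κ' l' y + c * F κ' l' y
    rw [hcurv y a, hF κ' l' y a]
  · intro κ' l' y
    show curv A κ' l' y + c * F κ' l' y = -(curv A l' κ' y + c * F l' κ' y)
    rw [curv_antisymm A κ' l' y, hFa κ' l' y]
    ring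
  · intro κ' l' m y
    show (curv A l' m (y + unitVec κ') + c * F l' m (y + unitVec κ') - (curv A l' m y + c * F l' m y)) +
        (curv A m κ' (y + unitVec l') + c * F m κ' (y + unitVec l') - (curv A m κ' y + c * F m κ' y)) +
        (curv A κ' l' (y + unitVec m) + c * F κ' l' (y + unitVec m) - (curv A κ' l' y + c * F κ' l' y)) = 0
    have h1 := curv_cyclic A κ' l' m y
    have h2 := hFcl κ' l' m y
    linear_combination h1 + c * h2

/-- [folklore] **… AND THE CONSTANT IS `c` TIMES THE CELL AVERAGE OF `F`**: `|box|·(curv A κ l 0 + c·F κ l 0) = c·Σ_{r ∈ box} F κ l (toSite r)`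
(the curvature of a periodic potential has zero cell sum). -/
theorem card_mul_const_eq_sum_box {A : Form1 d ℝ} {F : Form2 d ℝ} (hA : ∀ κ, IsPeriodic N (A κ)) (hF : ∀ κ l, IsPeriodic N (F κ l))
    (hFa : ∀ κ l x, F κ l x = -F l κ x)
    (hFcl : ∀ (κ l m : Fin d) (x : AffineAveraging.Site d),
      (F l m (x + unitVec κ) - F l m x) + (F m κ (x + unitVec l) - F m κ x) + (F κ l (x + unitVec m) - F κ l x) = 0)
    (c : ℝ) (hco : curvAdj (fun κ l x => curv A κ l x + c * F κ l x) = 0) (κ l : Fin d) :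
    ((box d N).card : ℝ) * (curv A κ l 0 + c * F κ l 0) = c * ∑ r ∈ box d N, F κ l (toSite r) := by
  have h : ∑ r ∈ box d N, (curv A κ l (toSite r) + c * F κ l (toSite r)) = ∑ r ∈ box d N, (curv A κ l 0 + c * F κ l 0) :=
    Finset.sum_congr rfl fun r _ => curv_add_eq_const (N := N) hA hF hFa hFcl c hco κ l (toSite r)
  rw [Finset.sum_const, nsmul_eq_mul, Finset.sum_add_distrib, sum_box_curv_eq_zero (N := N) hA, zero_add, ← Finset.mul_sum] at h
  exact h.symm

end Summit.QuantumFields.BalabanUV.Beta.GAN24.HarmonicPeriodicTwoForm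

end
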